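import Literature.MathematicalPhysics.QuantumFieldTheory.Balaban1983to89.B7Prop2Explicit

/-!
# [B7] (21)–(23), (42)–(43) AT EVERY RADIUS: THE SERIES LOGARITHM OF A UNITARY MATRIX IS SKEW, AND BLOCK AVERAGES OF `U(N)`-FIELDS ARE `U(N)`-VALUED

[Balaban1985Averaging] p. 21: (21) `log X = Σ_{n≥1} ((−1)^{n+1}/n)(X − 1)^n`, *"defined for |X − 1| < 1"*; (22)–(23): for `U ∈ G = U(N)` close
to `1`, `log U ∈ 𝔤 = i·(hermitian)`; (42) p. 23: `V̄_c = exp[Σ_x L^{−d} log V(Γ_{c,x})V(c)⁻¹]·V(c)`, and p. 24 (43): the averages are iterated —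
tacitly, `V̄` is again `G`-valued.

WHY THIS FILE.  In the tree the series (21) is the TOTAL function `MatrixLog.mlog X = ∑' n, c_n • (X − 1)^n` (Mathlib `tsum`: the sum where the series is
summable, `0` elsewhere), and every typed edition of (22)–(23) carries a radius (`B7Prop2Explicit.star_mlog_eq_neg`: `|u − 1| ≤ 1/4`;
`BlockAveragingFederbush.mlog_star`: `≤ 1/3`; …); consequently `B7Prop2Explicit.bavg_mem_unitaryUnits` ∕ `AvgClosed` ∕ `avgIter_mem` give the
`U(N)`-valuedness of the averaged fields `Ū^j` only inside [B7] Prop. 2's window, and so does the N06 knit letter's `parKnitY_mem_unitary_of_reg335P`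
(`B9Eq3124HZKnitPairReg335Y`).  But for `G = U(N) ⊂ M_N(ℂ)` with the operator norm (19) the skewness `(log u)⋆ = −log u` holds AT EVERY RADIUS for
the total function: inside `|u − 1| < 1` because `log u⋆ + log u` is a HERMITIAN matrix with `exp = u⋆u = 1`, hence `0` (spectral theorem); outside,
because for the normal matrix `u − 1` the series (21) is not summable (`‖(u−1)^n‖ ≥ ‖u−1‖^n ≥ 1` by the C⋆-identity, against the harmonic series) and
neither is the one for `u⋆`, so both sides are the junk value `0`.  Hence (42) maps `U(N)`-fields to `U(N)`-fields with NO smallness condition, and so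
does every iterate (43).  This is the input that makes the symmetry of the N06 cube letters at the knit transporter (`Δ′_a(U; parKnitY)`, `G′_□(U)`)
unconditional (`Node00.OpsYCubeDirInverseSymm.GpDirY_parKnitY_isSymmTr`, binder `hpar`; companion file `B9KnitTransporterUnitaryY`).

* §1 (any C⋆-algebra) ★ `star_mlog` (`(log X)⋆ = log X⋆`, EVERY `X`), `pow_norm_le_norm_pow_of_isSelfAdjoint`,
  ★ `pow_norm_le_norm_pow_of_isStarNormal` (`‖a‖^n ≤ ‖a^n‖`, normal `a`, `n ≥ 1`).
* §2 (`M_N(ℂ)`, operator norm) ★ `eq_zero_of_isHermitian_exp_eq_one`, `not_summable_logSeries_of_one_le_norm`, `mlog_eq_zero_of_one_le_norm`,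
  ★★★ `star_mlog_eq_neg_of_mem_unitary` ((22)–(23) at every radius), `mlog_mem_skewAdjoint_of_mem_unitary`, `star_mlog_eq_neg_of_mem_unitaryUnits`.
* §3 ★★ `bavg_mem_unitaryUnits_all` ((42) preserves `U(N)`-valuedness, no window), ★★ `avgIter_mem_unitaryUnits_all` ((43), every level),
  `hol_avgIter_mem_unitaryUnits_all`.

HONEST: elementary finite-dimensional analysis of the series (21); nothing of [B7] Props. 1–2's ESTIMATES is discharged (they remain the tree's
`prop2_explicit` …); no statement about `SU(N)` (the determinant condition is not addressed); nothing continuum ∕ OS ∕ Clay.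
-/

namespace Literature.MathematicalPhysics.QuantumFieldTheory.Balaban1983to89.B7UnitaryAveragesAllRadii

open NormedSpace
open Literature.Analysis.Complex (logSeriesCoeff logOnePlus)
open MatrixLog (mlog mlog_def exp_mlog norm_logSeriesCoeff_succ)
open B7BlockAvgLog (commute_mlog_right)
open B7Prop1Explicit (hol Wcx boxVec Xavg bavg expUnit seg)
open B7Prop2Explicit (avgIter avgIter_zero avgIter_succ rescale_mem_of hol_mem_of unitaryUnits mem_unitaryUnits)

noncomputable section

/-! ## §1 The series logarithm under `⋆`; norms of powers of normal elements (any C⋆-algebra) -/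

section CStar

variable {𝔸 : Type*} [CStarAlgebra 𝔸]

/-- the coefficients `(−1)^{n+1}/n` of (21) are real: `c̄_n = c_n`. [cite: Balaban1985Averaging, (21) p.21, bookkeeping] -/
private theorem star_logSeriesCoeff (k : ℕ) : star (logSeriesCoeff k) = logSeriesCoeff k := by
  rw [Literature.Analysis.Complex.logSeriesCoeff]
  simp

/-- ★ **`(log X)⋆ = log (X⋆)` FOR EVERY `X`** — for the total series function (21), summable or not (`⋆` is an isometric involution, so it maps the
partial sums of the series for `X` onto those for `X⋆`). [cite: Balaban1985Averaging, (21)–(23) p.21] -/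
theorem star_mlog (X : 𝔸) : star (mlog X) = mlog (star X) := by
  rw [mlog_def, mlog_def, Literature.Analysis.Complex.logOnePlus, Literature.Analysis.Complex.logOnePlus, tsum_star]
  refine tsum_congr fun k => ?_
  rw [star_smul, star_pow, star_sub, star_one, star_logSeriesCoeff]

/-- for a SELF-ADJOINT `b` and `n ≥ 1`: `‖b‖^n ≤ ‖b^n‖` (from the C⋆-identity `‖b^{2^m}‖ = ‖b‖^{2^m}`, `2^m ≥ n`, and submultiplicativity).
[cite: Balaban1985Averaging, (19) p.21, bookkeeping] -/
theorem pow_norm_le_norm_pow_of_isSelfAdjoint {b : 𝔸} (hb : IsSelfAdjoint b) (k : ℕ) : ‖b‖ ^ (k + 1) ≤ ‖b ^ (k + 1)‖ := by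
  rcases (norm_nonneg b).eq_or_lt with h0 | hpos
  · rw [← h0, zero_pow (Nat.succ_ne_zero k)]
    exact norm_nonneg _
  obtain ⟨r, hr⟩ : ∃ r : ℕ, 2 ^ (k + 1) = (k + 1) + (r + 1) := by
    have h := (k + 1).lt_two_pow_self
    exact ⟨2 ^ (k + 1) - (k + 1) - 1, by omega⟩
  have h2 : ‖b ^ 2 ^ (k + 1)‖ = ‖b‖ ^ 2 ^ (k + 1) := by
    rw [← coe_nnnorm, hb.nnnorm_pow_two_pow (k + 1), NNReal.coe_pow, coe_nnnorm]
  have hle : ‖b‖ ^ 2 ^ (k + 1) ≤ ‖b ^ (k + 1)‖ * ‖b‖ ^ (r + 1) := by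
    rw [← h2, hr, pow_add]
    exact (norm_mul_le _ _).trans (mul_le_mul_of_nonneg_left (norm_pow_le' b (Nat.succ_pos r)) (norm_nonneg _))
  rw [hr, pow_add] at hle
  exact le_of_mul_le_mul_right hle (pow_pos hpos _)

/-- ★ for a NORMAL `a` and `n ≥ 1`: `‖a‖^n ≤ ‖a^n‖` (`‖a^n‖² = ‖(a⋆a)^n‖ ≥ ‖a⋆a‖^n = ‖a‖^{2n}`). [cite: Balaban1985Averaging, (19) p.21, bookkeeping] -/
theorem pow_norm_le_norm_pow_of_isStarNormal (a : 𝔸) [ha : IsStarNormal a] (k : ℕ) : ‖a‖ ^ (k + 1) ≤ ‖a ^ (k + 1)‖ := by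
  have hcomm : Commute (star a) a := ha.star_comm_self
  have hsa : IsSelfAdjoint (star a * a) := IsSelfAdjoint.star_mul_self a
  have h1 : ‖star a * a‖ = ‖a‖ * ‖a‖ := CStarRing.norm_star_mul_self
  have h2 : ‖star (a ^ (k + 1)) * a ^ (k + 1)‖ = ‖a ^ (k + 1)‖ * ‖a ^ (k + 1)‖ := CStarRing.norm_star_mul_self
  have h3 : star (a ^ (k + 1)) * a ^ (k + 1) = (star a * a) ^ (k + 1) := by rw [star_pow, hcomm.mul_pow]
  have h4 := pow_norm_le_norm_pow_of_isSelfAdjoint hsa k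
  rw [h1, ← h3, h2, ← pow_two, ← pow_two, ← pow_mul, mul_comm 2 (k + 1), pow_mul] at h4
  exact (pow_le_pow_iff_left₀ (pow_nonneg (norm_nonneg a) _) (norm_nonneg _) two_ne_zero).1 h4

end CStar

/-! ## §2 `M_N(ℂ)` with the operator norm (19): `(log u)⋆ = −log u` for EVERY unitary `u` -/

section Matrices

open scoped Matrix.Norms.L2Operator

variable {n : Type} [Fintype n] [DecidableEq n]

/-- ★ a HERMITIAN matrix with `exp Z = 1` is `0` (spectral theorem: `Z = U·diag(λ)·U⋆`, `λ` real, `e^{λ_i} = 1`, so `λ = 0`).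
[cite: Balaban1985Averaging, (22)–(23) p.21, bookkeeping] -/
theorem eq_zero_of_isHermitian_exp_eq_one {Z : Matrix n n ℂ} (hZ : Z.IsHermitian) (h : exp Z = 1) : Z = 0 := by
  set U : Matrix n n ℂ := (hZ.eigenvectorUnitary : Matrix n n ℂ) with hUdef
  have hUu : U ∈ Matrix.unitaryGroup n ℂ := hZ.eigenvectorUnitary.2
  have hstarU : star U * U = 1 := Matrix.mem_unitaryGroup_iff'.mp hUu
  have hinv : U⁻¹ = star U := Matrix.inv_eq_left_inv hstarU
  have hUunit : IsUnit U := (Matrix.isUnit_iff_isUnit_det U).mpr (Matrix.isUnit_det_of_left_inverse hstarU)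
  set D : Matrix n n ℂ := Matrix.diagonal (RCLike.ofReal ∘ hZ.eigenvalues : n → ℂ) with hDdef
  have hspec : Z = U * D * U⁻¹ := by
    rw [hinv, hZ.spectral_theorem, Unitary.conjStarAlgAut_apply]
  have hexpZ : exp Z = U * exp D * U⁻¹ := by rw [hspec]; exact Matrix.exp_conj U D hUunit
  have hD1 : exp D = 1 :=
    calc exp D = U⁻¹ * (U * exp D * U⁻¹) * U := by
            rw [hinv, ← mul_assoc, ← mul_assoc, hstarU, one_mul, mul_assoc, hstarU, mul_one]
      _ = 1 := by rw [← hexpZ, h, mul_one, hinv, hstarU]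
  rw [hDdef, Matrix.exp_diagonal] at hD1
  have hev : hZ.eigenvalues = 0 := by
    funext i
    have hi := congrFun (congrFun hD1 i) i
    rw [Matrix.diagonal_apply_eq, Matrix.one_apply_eq, Pi.coe_exp, Function.comp_apply, ← Complex.exp_eq_exp_ℂ] at hi
    have hn := congrArg (fun z : ℂ => ‖z‖) hi
    simp only [Complex.norm_exp, norm_one, Real.exp_eq_one_iff] at hn
    simpa using hn
  exact hZ.eigenvalues_eq_zero_iff.mp hev

/-- for a unitary `u`, `u⋆` and `u` commute. [cite: Balaban1985Averaging, (22) p.21, bookkeeping] -/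
theorem commute_star_self_of_mem_unitary {u : Matrix n n ℂ} (hu : u ∈ unitary (Matrix n n ℂ)) : Commute (star u) u := by
  rw [Commute, SemiconjBy, Unitary.star_mul_self_of_mem hu, Unitary.mul_star_self_of_mem hu]

/-- OUTSIDE the disc of (21): for a unitary `u` with `|u − 1| ≥ 1` the series (21) is NOT summable — `u − 1` is normal, so `‖(u − 1)^n‖ ≥ ‖u − 1‖^n ≥ 1`,
and `Σ 1/n` diverges (finite dimension: summable ⇔ absolutely summable). [cite: Balaban1985Averaging, (21) p.21] -/
theorem not_summable_logSeries_of_one_le_norm {u : Matrix n n ℂ} (hu : u ∈ unitary (Matrix n n ℂ)) (h1 : 1 ≤ ‖u - 1‖) :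
    ¬ Summable (fun k : ℕ => logSeriesCoeff k • (u - 1) ^ k) := by
  letI : CStarAlgebra (Matrix n n ℂ) := {}
  intro hs
  haveI : IsStarNormal (u - 1) := ⟨by
    have hc := commute_star_self_of_mem_unitary hu
    rw [star_sub, star_one]
    exact (hc.sub_right (Commute.one_right _)).sub_left (Commute.one_left _)⟩
  have hn : Summable (fun k : ℕ => ‖logSeriesCoeff (k + 1) • (u - 1) ^ (k + 1)‖) :=
    (summable_nat_add_iff 1).mpr (summable_norm_iff.mpr hs)
  have hlow : ∀ k : ℕ, ((k + 1 : ℕ) : ℝ)⁻¹ ≤ ‖logSeriesCoeff (k + 1) • (u - 1) ^ (k + 1)‖ := by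
    intro k
    rw [norm_smul, norm_logSeriesCoeff_succ, Nat.cast_succ, one_div]
    have hp := pow_norm_le_norm_pow_of_isStarNormal (u - 1) k
    have h1' : (1 : ℝ) ≤ ‖u - 1‖ ^ (k + 1) := one_le_pow₀ h1
    have hk : (0 : ℝ) ≤ ((k : ℝ) + 1)⁻¹ := by positivity
    calc ((k : ℝ) + 1)⁻¹ = ((k : ℝ) + 1)⁻¹ * 1 := (mul_one _).symm
      _ ≤ ((k : ℝ) + 1)⁻¹ * ‖(u - 1) ^ (k + 1)‖ := mul_le_mul_of_nonneg_left (h1'.trans hp) hk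
  have hsum : Summable (fun k : ℕ => ((k + 1 : ℕ) : ℝ)⁻¹) :=
    hn.of_nonneg_of_le (fun k => by positivity) hlow
  exact Real.not_summable_natCast_inv ((summable_nat_add_iff 1).mp hsum)

/-- hence OUTSIDE the disc the total function (21) takes the junk value: `log u = 0` (Mathlib's `tsum` of a non-summable family).
[cite: Balaban1985Averaging, (21) p.21, bookkeeping] -/
theorem mlog_eq_zero_of_one_le_norm {u : Matrix n n ℂ} (hu : u ∈ unitary (Matrix n n ℂ)) (h1 : 1 ≤ ‖u - 1‖) : mlog u = 0 := by
  rw [mlog_def, Literature.Analysis.Complex.logOnePlus]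
  exact tsum_eq_zero_of_not_summable (not_summable_logSeries_of_one_le_norm hu h1)

/-- ★★★ **(22)–(23) AT EVERY RADIUS: `(log u)⋆ = −log u` for EVERY unitary `u ∈ U(N)`** (the series logarithm (21) as a total function; no condition
`|u − 1| < 1`).  Inside the disc: `X := log u⋆ = (log u)⋆` and `Y := log u` commute, `exp (X + Y) = u⋆u = 1`, and `X + Y` is Hermitian, hence `0`;
outside: both sides vanish. [cite: Balaban1985Averaging, (22)–(23) p.21] -/
theorem star_mlog_eq_neg_of_mem_unitary {u : Matrix n n ℂ} (hu : u ∈ unitary (Matrix n n ℂ)) : star (mlog u) = -mlog u := by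
  letI : CStarAlgebra (Matrix n n ℂ) := {}
  letI : NormedAlgebra ℚ (Matrix n n ℂ) := NormedAlgebra.restrictScalars ℚ ℂ (Matrix n n ℂ)
  have hn1 : ‖star u - 1‖ = ‖u - 1‖ := by rw [← norm_star (u - 1), star_sub, star_one]
  by_cases h1 : ‖u - 1‖ < 1
  · have hs1 : ‖star u - 1‖ < 1 := by rwa [hn1]
    have hc := commute_star_self_of_mem_unitary hu
    have hXY : Commute (mlog (star u)) (mlog u) := (commute_mlog_right (commute_mlog_right hc).symm).symm
    have hexp : exp (mlog (star u) + mlog u) = 1 :=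
      calc exp (mlog (star u) + mlog u) = exp (mlog (star u)) * exp (mlog u) := exp_add_of_commute hXY
        _ = star u * u := congrArg₂ (· * ·) (exp_mlog hs1) (exp_mlog h1)
        _ = 1 := Unitary.star_mul_self_of_mem hu
    have hX : mlog (star u) = star (mlog u) := (star_mlog u).symm
    have hH : (mlog (star u) + mlog u).IsHermitian := by
      show star (mlog (star u) + mlog u) = mlog (star u) + mlog u
      rw [star_add, hX, star_star, add_comm]
    have h0 := eq_zero_of_isHermitian_exp_eq_one hH hexp
    rw [hX] at h0
    exact eq_neg_of_add_eq_zero_left h0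
  · have h1' : 1 ≤ ‖u - 1‖ := not_lt.mp h1
    have h2 : 1 ≤ ‖star u - 1‖ := by rwa [hn1]
    rw [star_mlog, mlog_eq_zero_of_one_le_norm (Unitary.star_mem hu) h2, mlog_eq_zero_of_one_le_norm hu h1', neg_zero]

/-- (23): `log u ∈ 𝔤 = u(N)` (skew-adjoint matrices) for every unitary `u`. [cite: Balaban1985Averaging, (23) p.21] -/
theorem mlog_mem_skewAdjoint_of_mem_unitary {u : Matrix n n ℂ} (hu : u ∈ unitary (Matrix n n ℂ)) : mlog u ∈ skewAdjoint (Matrix n n ℂ) :=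
  skewAdjoint.mem_iff.mpr (star_mlog_eq_neg_of_mem_unitary hu)

/-- the `Units` edition: for `u ∈ unitaryUnits`, `(log u)⋆ = −log u`. [cite: Balaban1985Averaging, (22)–(23) p.21] -/
theorem star_mlog_eq_neg_of_mem_unitaryUnits {u : (Matrix n n ℂ)ˣ} (hu : u ∈ unitaryUnits (Matrix n n ℂ)) :
    star (mlog (u : Matrix n n ℂ)) = -mlog (u : Matrix n n ℂ) :=
  star_mlog_eq_neg_of_mem_unitary (mem_unitaryUnits.mp hu)

/-! ## §3 (42)–(43): block averages of `U(N)`-valued fields are `U(N)`-valued — NO smallness window -/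

variable {d : ℕ}

/-- ★★ **(42) maps `U(N)`-fields to `U(N)`-fields, unconditionally**: `X̄ = Σ L^{−d} log W_x` is a real combination of skew-adjoint matrices ((23) at
every radius), so `exp X̄` is unitary, and `V̄ = exp(X̄)·V(c)` is.  Compare `B7Prop2Explicit.bavg_mem_unitaryUnits` (needs `|W_x − 1| ≤ 1/4`).
[cite: Balaban1985Averaging, (42) p.23, (22)–(23) p.21] -/
theorem bavg_mem_unitaryUnits_all {V : B7Prop1Explicit.Site d → Fin d → (Matrix n n ℂ)ˣ} (hV : ∀ x κ, V x κ ∈ unitaryUnits (Matrix n n ℂ)) (L : ℕ)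
    (q : B7Prop1Explicit.Site d) (κ : Fin d) : bavg L V q κ ∈ unitaryUnits (Matrix n n ℂ) := by
  letI : CStarAlgebra (Matrix n n ℂ) := {}
  have hWm : ∀ r : Fin d → Fin L, ((Wcx L V q κ (boxVec L r) : (Matrix n n ℂ)ˣ) : Matrix n n ℂ) ∈ unitary (Matrix n n ℂ) :=
    fun r => (unitaryUnits (Matrix n n ℂ)).mul_mem (hol_mem_of hV _ _) ((unitaryUnits (Matrix n n ℂ)).inv_mem (hol_mem_of hV _ _))
  have hX : Xavg L V q κ ∈ skewAdjoint (Matrix n n ℂ) := by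
    unfold Xavg
    refine sum_mem fun r _ => skewAdjoint.smul_mem _ ?_
    exact mlog_mem_skewAdjoint_of_mem_unitary (hWm r)
  have hexp : ((expUnit (Xavg L V q κ) : (Matrix n n ℂ)ˣ) : Matrix n n ℂ) ∈ unitary (Matrix n n ℂ) := by
    letI : NormedAlgebra ℚ (Matrix n n ℂ) := NormedAlgebra.restrictScalars ℚ ℂ (Matrix n n ℂ)
    exact NormedSpace.exp_mem_unitary_of_mem_skewAdjoint hX
  show bavg L V q κ ∈ unitaryUnits (Matrix n n ℂ)
  unfold bavg
  exact mul_mem (mem_unitaryUnits.mpr hexp) (hol_mem_of hV _ _)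

/-- ★★ **(43) at every level, unconditionally**: all the iterated averages `Ū^j` of a `U(N)`-valued field are `U(N)`-valued.  Compare
`B7Prop2Explicit.avgIter_mem` (inside Prop. 2's window only). [cite: Balaban1985Averaging, (43) p.24] -/
theorem avgIter_mem_unitaryUnits_all (L : ℕ) {V : B7Prop1Explicit.Site d → Fin d → (Matrix n n ℂ)ˣ} (hV : ∀ x κ, V x κ ∈ unitaryUnits (Matrix n n ℂ)) :
    ∀ j x κ, avgIter L V j x κ ∈ unitaryUnits (Matrix n n ℂ) := by
  intro j
  induction j with
  | zero => intro x κ; rw [avgIter_zero]; exact hV x κ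
  | succ j ih =>
      intro x κ
      rw [avgIter_succ]
      exact rescale_mem_of (fun y μ => bavg_mem_unitaryUnits_all ih L y μ) L x κ

/-- parallel transporters of every `Ū^j` are `U(N)`-valued. [cite: Balaban1985Averaging, (43) p.24, bookkeeping] -/
theorem hol_avgIter_mem_unitaryUnits_all (L : ℕ) {V : B7Prop1Explicit.Site d → Fin d → (Matrix n n ℂ)ˣ} (hV : ∀ x κ, V x κ ∈ unitaryUnits (Matrix n n ℂ))
    (j : ℕ) (x : B7Prop1Explicit.Site d) (w : List (B7Prop1Explicit.Letter d)) : hol (avgIter L V j) x w ∈ unitaryUnits (Matrix n n ℂ) :=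
  hol_mem_of (avgIter_mem_unitaryUnits_all L hV j) x w

end Matrices

end

end Literature.MathematicalPhysics.QuantumFieldTheory.Balaban1983to89.B7UnitaryAveragesAllRadii
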